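import Literature.NumberTheory.Automorphic.ArchSchwartzSpace       -- ★ p848256 `archHSGL`; brings ★ `UnitaryGroup.arch`, `archAt`, `coe_archAt_apply`, `archLocal`
import Literature.NumberTheory.Automorphic.LocalUnitaryGroupCongr   -- ★ `isUnit_antidiagOne_det` (the form `Φ_N`)
import Literature.Analysis.InnerProduct.GramHadamard                -- ★ `norm_det_le_prod_norm` (Hadamard's inequality)
import Mathlib.Analysis.MeanInequalities
import Mathlib.Analysis.InnerProductSpace.PiL2
import HarnessLib

/-!
# The Hilbert–Schmidt radius is at least `N` on the unitary group of a non-degenerate form: `N ≤ ‖k_w‖²_HS` at every complex place,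
# hence `1 ≤ archHSGL L N k` on `U(J)(L⁺ ⊗ ℝ)` — the «radius `≥ 1`» socket of the Schwartz-orbital-integral convergence lemma (CONV)

Topic `NumberTheory/Automorphic`; namespace `Literature.NumberTheory.Automorphic`.  THEOREMS ONLY (no `def`, no instance, no notation, no axiom,
no named fact, no `sorry`).  Cell `pub/hodgecm-mathlib`, crux H413 (`stmt-HodgeConjecture-24833`), programme F0∕P3c «GO 500» half A: DEAL #13 (C)
of LH3-plan (g0) to seat LH2-p02 (g2) (reusable (VOL)∕(CONV) kit on lane 24833, serving line LH3 (`stub_N9`, carrier `H_∞`) and line LH2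
(`stub_N8`, carriers `G_∞ = U(Φ₃)(L⁺ ⊗ ℝ)`, `G′_∞ = U(H)(L⁺ ⊗ ℝ)`) alike).

THE MATHEMATICS.  Let `J ∈ M_N(ℂ)` with `det J ≠ 0` and `M ∈ M_N(ℂ)` with `Mᴴ J M = J` (a point of the unitary group of the form `J`, ★
`UnitaryGroup.archLocal`).  Taking determinants, `conj(det M) · det J · det M = det J`, so `|det M| = 1` (`norm_det_eq_one_of_conjTranspose_mul_mul_eq`).
By Hadamard's inequality `|det M| ≤ ∏_k ‖M e_k‖` (★ `Literature.Analysis.InnerProduct.norm_det_le_prod_norm` in the standard orthonormal basis of `ℂ^N`)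
and the inequality of arithmetic and geometric means, `N = N · |det M|^{2∕N} ≤ N · (∏_k ‖M e_k‖²)^{1∕N} ≤ Σ_k ‖M e_k‖² = Σ_{i,j} |M_{ij}|² = ‖M‖²_HS`
(`card_le_sum_normSq_of_one_le_norm_det`).  For `k ∈ U(J)(L⁺ ⊗ ℝ)` (★ `UnitaryGroup.arch`, CM field `L`, `J ∈ M_N(L)` with `det J ≠ 0`) the
`w`-component `k_w = archAt w k ∈ U(σ_w J)(ℂ)` (★ `archAt`, membership ★ `mem_archLocal_iff_conjTranspose`; `det σ_w(J) = σ_w(det J) ≠ 0`) therefore has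
`N ≤ Σ_{i,j} |k_{ij,w}|²` (`card_le_hsPlace_arch`), and the product over the complex places gives `N^{#places} ≤ archHSGL L N k` (★ `archHSGL` =
`∏_w Σ_{i,j} |k_{ij,w}|²`), in particular **`1 ≤ archHSGL L N k` for `N ≥ 1`** (`one_le_archHSGL_arch`; `Φ_N`-instance `one_le_archHSGL_arch_antidiagOne` by ★
`isUnit_antidiagOne_det`).  This is the hypothesis «radius `P ≥ 1`» of ★ `integrable_of_norm_mul_weight_le_of_dyadic_volume` (p848470 §1) for the carrier
`U(J)(L⁺ ⊗ ℝ) ↪ GL_N(L ⊗ ℝ)` — on `H_∞` it was read off ★ `archHSGL_endoEmbArch` (a product of factors `Σ|·|² + 1`); on `G_∞`, `G′_∞` there is no `+ 1` and the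
bound is this determinant argument.  In Beuzart-Plessis' language: `log archHSGL` is an abstract log-norm (`σ ≥ 1` after adding `1`; norms `‖g‖_G = e^{σ(g)} ≥ 1`).
HONEST LABEL: HC_CM is proved only modulo the 7 printed citations (2 remaining: hLiu418 = stmt-HodgeConjecture-24832, h413 = stmt-HodgeConjecture-24833) until
rung 0 closes; this file closes no organ — it is one socket of the (CONV)∕(VOL) kit, itself A3-hardening of the letters O1″∕O3″ of `stub_N8` and O1∕O3 of `stub_N9`.

## References
* [BeuzartPlessis2020Asterisque] R. Beuzart-Plessis, *A local trace formula for the Gan–Gross–Prasad conjecture for unitary groups: the archimedean case*,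
  Astérisque 418 (2020): §1.2 pp. 19–21 (log-norms `σ ≥ 1`, norms `‖g‖_G = e^{σ(g)}`), §1.5 Prop. 1.5.1 (i) pp. 29–30 (held scan `paper:doi-10-24033-ast-1120`,
  p0020 L1–2, p0022 L9–13, p0030–p0031).
* [HornJohnson2013] R. A. Horn, C. R. Johnson, *Matrix Analysis*, 2nd ed. (2013), §7.8 Thm. 7.8.1 (Hadamard's inequality), as used by ★
  `Literature/LinearAlgebra/Matrix/HadamardInequality.lean`.
* [PlatonovRapinchuk1994] V. Platonov, A. Rapinchuk, *Algebraic Groups and Number Theory* (1994), §2.3 (unitary groups of hermitian forms).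
-/

set_option autoImplicit false

noncomputable section

open NumberField NumberField.InfinitePlace NumberField.mixedEmbedding
open scoped Matrix ComplexConjugate Classical

namespace Literature.NumberTheory.Automorphic

/-! ## §1 Complex matrices: `|det M| = 1 ⇒ N ≤ ‖M‖²_HS` -/

section ComplexMatrix

variable {N : ℕ}

/-- Hadamard's inequality in column form for a complex `N × N` matrix: `|det M| ≤ ∏_k (Σ_j |M_{jk}|²)^{1∕2}` (★ `norm_det_le_prod_norm` in the standard
orthonormal basis of `ℂ^N`). [cite: HornJohnson2013, §7.8 Thm 7.8.1] -/
theorem norm_det_le_prod_sqrt_sum_normSq_col (M : Matrix (Fin N) (Fin N) ℂ) :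
    ‖M.det‖ ≤ ∏ k, Real.sqrt (∑ j, ‖M j k‖ ^ 2) := by
  classical
  let f : Fin N → EuclideanSpace ℂ (Fin N) := fun k => WithLp.toLp 2 fun j => M j k
  have hf : ∀ k, ‖f k‖ = Real.sqrt (∑ j, ‖M j k‖ ^ 2) := fun k => by
    rw [EuclideanSpace.norm_eq]
  set e := EuclideanSpace.basisFun (Fin N) ℂ with he
  have hdet : M.det = e.toBasis.det f := by
    rw [Module.Basis.det_apply]
    rfl
  rw [hdet]
  refine (Literature.Analysis.InnerProduct.norm_det_le_prod_norm e f).trans (le_of_eq ?_)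
  exact Finset.prod_congr rfl fun k _ => hf k

/-- **`1 ≤ |det M| ⇒ N ≤ Σ_{i,j} |M_{ij}|²`** for a complex `N × N` matrix: Hadamard's inequality gives `1 ≤ ∏_k c_k` with `c_k = Σ_j |M_{jk}|²` the squared
column norms, and the inequality of arithmetic and geometric means gives `N ≤ N (∏_k c_k)^{1∕N} ≤ Σ_k c_k`. [cite: HornJohnson2013, §7.8 Thm 7.8.1] -/
theorem card_le_sum_normSq_of_one_le_norm_det (M : Matrix (Fin N) (Fin N) ℂ) (hM : 1 ≤ ‖M.det‖) :
    (N : ℝ) ≤ ∑ i, ∑ j, ‖M i j‖ ^ 2 := by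
  rcases Nat.eq_zero_or_pos N with hN | hN
  · subst hN
    simp
  -- squared column norms
  set c : Fin N → ℝ := fun k => ∑ j, ‖M j k‖ ^ 2 with hc
  have hc0 : ∀ k, 0 ≤ c k := fun k => Finset.sum_nonneg fun j _ => by positivity
  -- Hadamard: `1 ≤ ∏ √c_k`, hence `1 ≤ ∏ c_k`
  have h1 : 1 ≤ ∏ k, Real.sqrt (c k) := hM.trans (norm_det_le_prod_sqrt_sum_normSq_col M)
  have h2 : 1 ≤ ∏ k, c k := by
    have hsq : (∏ k, Real.sqrt (c k)) ^ 2 = ∏ k, c k := by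
      rw [← Finset.prod_pow]
      exact Finset.prod_congr rfl fun k _ => Real.sq_sqrt (hc0 k)
    have h0 : 0 ≤ ∏ k, Real.sqrt (c k) := Finset.prod_nonneg fun k _ => Real.sqrt_nonneg _
    calc (1 : ℝ) = 1 ^ 2 := by norm_num
      _ ≤ (∏ k, Real.sqrt (c k)) ^ 2 := by gcongr
      _ = ∏ k, c k := hsq
  -- AM–GM with equal weights `1 / N`
  have hNpos : (0 : ℝ) < N := Nat.cast_pos.2 hN
  have hw : ∑ _k : Fin N, (1 / (N : ℝ)) = 1 := by
    rw [Finset.sum_const, Finset.card_univ, Fintype.card_fin, nsmul_eq_mul]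
    field_simp
  have hamgm := Real.geom_mean_le_arith_mean_weighted (Finset.univ : Finset (Fin N)) (fun _ => 1 / (N : ℝ)) c
    (fun _ _ => by positivity) hw (fun k _ => hc0 k)
  -- `∏ c_k ^ (1/N) = (∏ c_k) ^ (1/N) ≥ 1`
  have hgm : (1 : ℝ) ≤ ∏ k, c k ^ (1 / (N : ℝ)) := by
    rw [Real.finsetProd_rpow Finset.univ c (fun k _ => hc0 k)]
    exact Real.one_le_rpow h2 (by positivity)
  -- `∑ (1/N) c_k = (∑ c_k) / N`
  have hsum : ∑ k, 1 / (N : ℝ) * c k = (∑ k, c k) / N := by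
    rw [← Finset.mul_sum]
    ring
  have h3 : (1 : ℝ) ≤ (∑ k, c k) / N := hgm.trans (hsum ▸ hamgm)
  have h4 : (N : ℝ) ≤ ∑ k, c k := by
    rwa [le_div_iff₀ hNpos, one_mul] at h3
  -- reorder the double sum (columns first)
  calc (N : ℝ) ≤ ∑ k, c k := h4
    _ = ∑ k, ∑ j, ‖M j k‖ ^ 2 := rfl
    _ = ∑ i, ∑ j, ‖M i j‖ ^ 2 := Finset.sum_comm

/-- **`|det M| = 1` on the unitary group of a non-degenerate form**: `Mᴴ J M = J` with `det J ≠ 0` forces `conj(det M) · det M = 1`.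
[cite: PlatonovRapinchuk1994, §2.3] -/
theorem norm_det_eq_one_of_conjTranspose_mul_mul_eq {J M : Matrix (Fin N) (Fin N) ℂ} (hJ : J.det ≠ 0) (h : Mᴴ * J * M = J) :
    ‖M.det‖ = 1 := by
  have hd := congrArg Matrix.det h
  rw [Matrix.det_mul, Matrix.det_mul, Matrix.det_conjTranspose] at hd
  -- `star (det M) * det J * det M = det J` ⇒ `star (det M) * det M = 1`
  have h1 : star M.det * M.det = 1 := by
    have h2 : (star M.det * M.det) * J.det = 1 * J.det := by
      rw [one_mul]
      calc star M.det * M.det * J.det = star M.det * J.det * M.det := by ring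
        _ = J.det := hd
    exact mul_right_cancel₀ hJ h2
  have h3 : ‖M.det‖ ^ 2 = 1 := by
    have h4 := congrArg (fun z : ℂ => ‖z‖) h1
    simp only [norm_mul, norm_star, norm_one] at h4
    nlinarith [h4, norm_nonneg M.det]
  have h5 : 0 ≤ ‖M.det‖ := norm_nonneg _
  nlinarith [h3, h5]

/-- **`N ≤ ‖M‖²_HS` on the unitary group of a non-degenerate form** (`Mᴴ J M = J`, `det J ≠ 0`). [cite: BeuzartPlessis2020Asterisque, §1.2 pp. 19–21] -/
theorem card_le_sum_normSq_of_conjTranspose_mul_mul_eq {J M : Matrix (Fin N) (Fin N) ℂ} (hJ : J.det ≠ 0) (h : Mᴴ * J * M = J) :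
    (N : ℝ) ≤ ∑ i, ∑ j, ‖M i j‖ ^ 2 :=
  card_le_sum_normSq_of_one_le_norm_det M (norm_det_eq_one_of_conjTranspose_mul_mul_eq hJ h).ge

end ComplexMatrix

/-! ## §2 `U(J)(L⁺ ⊗ ℝ)` for a CM field `L`: `N ≤ Σ_{i,j} |k_{ij,w}|²` at each complex place, `N^{#places} ≤ archHSGL L N k`, `1 ≤ archHSGL L N k` -/

section Arch

variable (L : Type) [Field L] [NumberField L] [IsCMField L] (N : ℕ) (J : Matrix (Fin N) (Fin N) L)

/-- The local component at a complex place `w` of a point of `U(J)(L⁺ ⊗ ℝ)` is `σ_w(J)`-unitary: `k_wᴴ σ_w(J) k_w = σ_w(J)` for the matrix `k_w = ((k_{ij})_w)`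
(★ `archAt`, ★ `mem_archLocal_iff_conjTranspose`, ★ `coe_archAt_apply`). [cite: PlatonovRapinchuk1994, §2.3] -/
theorem conjTranspose_mul_mul_placeMatrix_arch
    (k : ↥(UnitaryGroup.arch (↥(maximalRealSubfield L)) L (IsCMField.complexConj L) N J)) (w : {w : InfinitePlace L // w.IsComplex}) :
    (Matrix.of fun i j : Fin N => (((k : GL (Fin N) (mixedSpace L)) : Matrix (Fin N) (Fin N) (mixedSpace L)) i j).2 w)ᴴ *
        J.map w.1.embedding *
      (Matrix.of fun i j : Fin N => (((k : GL (Fin N) (mixedSpace L)) : Matrix (Fin N) (Fin N) (mixedSpace L)) i j).2 w) =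
      J.map w.1.embedding := by
  have hmem := (UnitaryGroup.archAt (↥(maximalRealSubfield L)) L (IsCMField.complexConj L) N J w
    (UnitaryGroup.complexConj_smul_infinitePlace L w.1) (IsCMField.complexConj_ne_one L) k).2
  rw [UnitaryGroup.mem_archLocal_iff_conjTranspose] at hmem
  have hmat : (Matrix.of fun i j : Fin N => (((k : GL (Fin N) (mixedSpace L)) : Matrix (Fin N) (Fin N) (mixedSpace L)) i j).2 w) =
      (((UnitaryGroup.archAt (↥(maximalRealSubfield L)) L (IsCMField.complexConj L) N J w
        (UnitaryGroup.complexConj_smul_infinitePlace L w.1) (IsCMField.complexConj_ne_one L) k :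
          UnitaryGroup.archLocal L N J w) : GL (Fin N) ℂ) : Matrix (Fin N) (Fin N) ℂ) := by
    ext i j
    rw [Matrix.of_apply, UnitaryGroup.coe_archAt_apply]
  rw [hmat]
  exact hmem

variable {J} in
omit [NumberField L] [IsCMField L] in
/-- `det σ_w(J) ≠ 0` when `det J ≠ 0` (`σ_w` is a ring embedding `L ↪ ℂ`). [cite: PlatonovRapinchuk1994, §2.3] -/
theorem det_map_embedding_ne_zero (hJ : J.det ≠ 0) (w : {w : InfinitePlace L // w.IsComplex}) : (J.map w.1.embedding).det ≠ 0 := by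
  have h : (J.map w.1.embedding).det = w.1.embedding J.det := by
    rw [RingHom.map_det]
    rfl
  rw [h]
  exact (map_ne_zero w.1.embedding).2 hJ

variable {J} in
/-- **`N ≤ Σ_{i,j} |k_{ij,w}|²` at every complex place `w`** for `k ∈ U(J)(L⁺ ⊗ ℝ)`, `det J ≠ 0` (the place component is `σ_w(J)`-unitary, so `|det k_w| = 1`;
Hadamard + AM–GM). [cite: BeuzartPlessis2020Asterisque, §1.2 pp. 19–21] -/
theorem card_le_hsPlace_arch (hJ : J.det ≠ 0)
    (k : ↥(UnitaryGroup.arch (↥(maximalRealSubfield L)) L (IsCMField.complexConj L) N J)) (w : {w : InfinitePlace L // w.IsComplex}) :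
    (N : ℝ) ≤ ∑ i : Fin N, ∑ j : Fin N, ‖(((k : GL (Fin N) (mixedSpace L)) : Matrix (Fin N) (Fin N) (mixedSpace L)) i j).2 w‖ ^ 2 := by
  have h := card_le_sum_normSq_of_conjTranspose_mul_mul_eq (det_map_embedding_ne_zero L N hJ w)
    (conjTranspose_mul_mul_placeMatrix_arch L N J k w)
  simpa only [Matrix.of_apply] using h

variable {J} in
/-- **`N^{#complex places} ≤ archHSGL L N k`** for `k ∈ U(J)(L⁺ ⊗ ℝ)`, `det J ≠ 0` (★ `archHSGL` is the product over the complex places of the place radii).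
[cite: BeuzartPlessis2020Asterisque, §1.5 Prop. 1.5.1 (i) pp. 29–30] -/
theorem card_pow_le_archHSGL_arch (hJ : J.det ≠ 0)
    (k : ↥(UnitaryGroup.arch (↥(maximalRealSubfield L)) L (IsCMField.complexConj L) N J)) :
    (N : ℝ) ^ Fintype.card {w : InfinitePlace L // w.IsComplex} ≤ archHSGL L N (k : GL (Fin N) (mixedSpace L)) := by
  unfold archHSGL
  rw [← Finset.card_univ, ← Finset.prod_const]
  exact Finset.prod_le_prod (fun _ _ => Nat.cast_nonneg N) fun w _ => card_le_hsPlace_arch L N hJ k w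

variable {J} in
/-- **`1 ≤ archHSGL L N k` for `k ∈ U(J)(L⁺ ⊗ ℝ)`**, `N ≥ 1`, `det J ≠ 0` — the «radius `≥ 1`» hypothesis of the dyadic convergence lemma ★
`integrable_of_norm_mul_weight_le_of_dyadic_volume` for the carriers `G_∞ = U(Φ₃)(L⁺ ⊗ ℝ)`, `G′_∞ = U(H)(L⁺ ⊗ ℝ)` (and any `U(J)_∞`).
[cite: BeuzartPlessis2020Asterisque, §1.2 pp. 19–21; §1.5 Prop. 1.5.1 (i) pp. 29–30] -/
theorem one_le_archHSGL_arch [NeZero N] (hJ : J.det ≠ 0)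
    (k : ↥(UnitaryGroup.arch (↥(maximalRealSubfield L)) L (IsCMField.complexConj L) N J)) :
    1 ≤ archHSGL L N (k : GL (Fin N) (mixedSpace L)) := by
  refine le_trans ?_ (card_pow_le_archHSGL_arch L N hJ k)
  have h1 : (1 : ℝ) ≤ N := by exact_mod_cast Nat.one_le_iff_ne_zero.2 (NeZero.ne N)
  exact one_le_pow₀ h1

variable {J} in
/-- **`0 < archHSGL L N k` on `U(J)(L⁺ ⊗ ℝ)`** (`N ≥ 1`, `det J ≠ 0`). [cite: BeuzartPlessis2020Asterisque, §1.2 pp. 19–21] -/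
theorem archHSGL_arch_pos [NeZero N] (hJ : J.det ≠ 0)
    (k : ↥(UnitaryGroup.arch (↥(maximalRealSubfield L)) L (IsCMField.complexConj L) N J)) :
    0 < archHSGL L N (k : GL (Fin N) (mixedSpace L)) :=
  lt_of_lt_of_le one_pos (one_le_archHSGL_arch L N hJ k)

variable {J} in
/-- **`log archHSGL L N k ≥ 0` on `U(J)(L⁺ ⊗ ℝ)`** — `log archHSGL` is an abstract log-norm in Beuzart-Plessis' sense once shifted by `1` (`1 + log archHSGL ≥ 1`).
[cite: BeuzartPlessis2020Asterisque, §1.2 pp. 19–21] -/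
theorem log_archHSGL_arch_nonneg [NeZero N] (hJ : J.det ≠ 0)
    (k : ↥(UnitaryGroup.arch (↥(maximalRealSubfield L)) L (IsCMField.complexConj L) N J)) :
    0 ≤ Real.log (archHSGL L N (k : GL (Fin N) (mixedSpace L))) :=
  Real.log_nonneg (one_le_archHSGL_arch L N hJ k)

/-- **The quasi-split instance `J = Φ_N`** (`G_∞ = U(Φ₃)(L⁺ ⊗ ℝ) = U(2,1)^d` at `N = 3`; `det Φ_N` is a unit, ★ `isUnit_antidiagOne_det`): `1 ≤ archHSGL L N k`.
[cite: BeuzartPlessis2020Asterisque, §1.5 Prop. 1.5.1 (i) pp. 29–30] -/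
theorem one_le_archHSGL_arch_antidiagOne [NeZero N]
    (k : ↥(UnitaryGroup.arch (↥(maximalRealSubfield L)) L (IsCMField.complexConj L) N
      (Matrix.of fun i j : Fin N => if i.val + j.val + 1 = N then (1 : L) else 0))) :
    1 ≤ archHSGL L N (k : GL (Fin N) (mixedSpace L)) :=
  one_le_archHSGL_arch L N (UnitaryGroup.isUnit_antidiagOne_det L N).ne_zero k

/-- **`N ≤ Σ_{i,j} |k_{ij,w}|²` at every complex place on `U(Φ_N)(L⁺ ⊗ ℝ)`** (e.g. `3 ≤ ‖k_w‖²_HS` on each `U(2,1)`-factor of `G_∞`).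
[cite: BeuzartPlessis2020Asterisque, §1.2 pp. 19–21] -/
theorem card_le_hsPlace_arch_antidiagOne
    (k : ↥(UnitaryGroup.arch (↥(maximalRealSubfield L)) L (IsCMField.complexConj L) N
      (Matrix.of fun i j : Fin N => if i.val + j.val + 1 = N then (1 : L) else 0)))
    (w : {w : InfinitePlace L // w.IsComplex}) :
    (N : ℝ) ≤ ∑ i : Fin N, ∑ j : Fin N, ‖(((k : GL (Fin N) (mixedSpace L)) : Matrix (Fin N) (Fin N) (mixedSpace L)) i j).2 w‖ ^ 2 :=
  card_le_hsPlace_arch L N (UnitaryGroup.isUnit_antidiagOne_det L N).ne_zero k w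

end Arch

end Literature.NumberTheory.Automorphic

end
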